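import Summits.QuantumFields.BalabanUV.T4Continuum.Support.T4TrajectoryDensityAssemblyModWin
import Summits.QuantumFields.BalabanUV.T4Continuum.Spine.NE1p.DressedTransportAssembledMod
import Summits.QuantumFields.BalabanUV.T4Continuum.Spine.NE1p.DressedRootWin

/-!
# T⁴ programme, spine estimate NE1′ (node O3b/H2) — END-F′-mod-win: THE TRANSPORT LEAF WITH `hP` ASSEMBLED FROM RESPONSE MODULI
# AND PER-STEP CHART WINDOWS IN THE (N2) NESTING — no chart-radius floor, cutoff-free source-vs-budget condition; the SLICE window
# `w` of the cross-family complex margins is still uniform (leaf-04's finding F-ne1pleaf04-1, recorded below)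
# (suppliers «R-a′» ∘ «R-b», finding F-ne1pleaf08-1)

Cell `pub-balaban`, sub-cell `t4`, BINDER-OWNERS row NE1′, NE1′ formalisation swarm `b2b-balaban-t4-ne1p-formalise-*`, leaf prover
08 (own-initiative SUPPLIER items «R-a′»/«R-b», HOME/CLAIMS.log l.8748 / l.9001 / l.9160 / l.9227; not crew rows); tree target
`Summits/QuantumFields/BalabanUV/T4Continuum/Spine/NE1p/`; ADDITIVE — imports `Support/T4TrajectoryDensityAssemblyModWin` (the moduli
induction with per-step windows, this seat), `Spine/NE1p/DressedTransportAssembledMod` (END-F′-mod, this seat; for `budgetShare_le_mod`)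
and `Spine/NE1p/DressedRootWin` (END-F-win, this seat) ONLY; modifies nothing; END-F / END-F′ of the owner and of row S2 stay the
faces of record unless the owner adopts this one.  WHAT THIS FACE IS AND IS NOT (leaf-04's located finding F-ne1pleaf04-1,
HOME/CLAIMS.log 2026-08-20T08:57:28Z, acknowledged): its scalar ties to `UniformConstants` are cutoff-free by shape (`C = 4c_δ/r`, rate
`ψ·α`, `‖c b k‖ ≤ m`; NO radius floor) and its OWN-family (N1)/(N2) nestings consume `Σ_k (wk b k′ k + diam D b k)` of birth window
(summable for geometric data); BUT the cross-family complex margin `hN2cx` and the fresh pairs `hpairx` — like the produced `hP`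
and the chain's slice shapes `hsl`/`hE`/`hop` — are still typed at the UNIFORM slice window `w` (`∀ pd, 0 < latN pd → latN pd ≤ w →
∀ t ∈ tube (ϱ₁ b k / latN pd), …`), and a real chart motion to `t = 1` along a direction of declared bound `w` displaces a bond by up
to `w`: for bond-ball windows every met step therefore still consumes `≥ w + ϱ₁ b k + σ k`, i.e. the birth window is `≥ K·w + Σ_k
(ϱ₁ k + σ k)` — NOT cutoff-free.  The remaining cure is a per-step SLICE window (all one-step lemmas are window-parametric and the
slice shapes antitone in `w`); it is leaf-04's announced `…PerSliceWindow` / `…AssemblyModSliceWin` / `…ModSliceWin` re-cut on top of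
this seat's landed modules.  Until then every «cutoff-free birth window» headline about an ASSEMBLED transport leaf must say «slice
window uniform: K·w remains» (c4/k1).

WHY.  Row S2's END-F′ sizes the fresh response of a live generation by its SLICE data `4·Asz/rs` and therefore needs a uniform
chart-radius floor `r_* ≤ rs` tied to the budget factor by `‖c‖·r ≤ m·r_*`; composed with row S1's window schedule this forces
`K·r_* < ρw 0` and `m ≥ K·‖c‖·r/ρw 0` (finding F-ne1pleaf08-1; kernel: `DressedTransportScheduled.floor_window_budget` p212880,
`DressedRootWin.budgetFactor_lower_bound`) — a cutoff-dependent `UniformConstants.m` (trigger caveat k1); a geometric floor is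
unsatisfiable jointly with `hmargin` in mixed-age components (leaf-04, l.8878).  The moduli route prices the same response by the
generation's transported RESPONSE MODULUS `(4/r)·stepProd α k″ k·gen` (birth radius `r`, scale-free step factor), which IS the
booking's envelope term: the budget share `s1 ≤ m·Σ envVar` then holds outright from `‖c b k‖ ≤ m`, and no radius enters any
constant — the chart radii may shrink geometrically (so the complex margins consume a summable amount of window) at no cost.

CONTENTS.  **`transportLeaf_assembled_mod_win`** — END-F′-mod-win [bookkeeping] (= END-F′-mod with the (N2) guard re-cut; step (d) is END-F-win).

HONEST FRAMING.  Rung (B)+1 bookkeeping on ONE finite four-torus of fixed physical size — NOT infinite volume, NOT a mass gap, NOT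
OS on ℝ⁴, NOT the Clay problem, NOT summit progress.  NE1′ is NOT PRINTED and NOT PROVED; this file reads «L-T ⇐ F-1, F-2, F-3,
F-5…F-9 + the Assembly's dictionary/geometry binders (modulus form, per-step windows)», never «NE1′ proved»: every wall binder of
`t4/T4-EST-NE1p-P1.md` §4 stays DISPLAYED ((w1) `hsl`, H2 `hFn`/`hQ`, (w2-act) `hB`/`hE` — printed TYPE [Balaban1989LargeFieldII]
(1.65) p. 375, (1.71)–(1.75) pp. 379–380, asserted for Bałaban's densities NOWHERE —, (w3)⁺ nesting, (w4) `hdom`, (I4′) `hrate`/`hδf`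
— the cell's READING, CITED-FACTS-T4 v1 §2/§4 —, attainment, invariance); 0 binders instantiated on Bałaban's densities; no
`def … : Prop`; [folklore] kernel glue, 0 sorry, 0 citations used as hypothesis-free facts.  Spine PROVED 0∕9 unchanged.  HONEST
DEPENDENCY: continuum YM on T⁴ ⇐ BetaPertH ∧ nine spine estimates (0/9 proved); BetaPertH ⇐ (D1) ∧ (D4) ∧ CAP+tail; G-an2-4 gates
asym, D1 and NE2/3/4.
-/

noncomputable section

namespace Summit.QuantumFields.BalabanUV.T4Continuum.NE1p.DressedTransportAssembledModWin

open MeasureTheory Set Metric Filter Finset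
open scoped BigOperators
open Literature.MathematicalPhysics.QuantumFieldTheory.Balaban1983to89
open Literature.MathematicalPhysics.QuantumFieldTheory.Balaban1983to89.T4TermFormat
open Literature.MathematicalPhysics.QuantumFieldTheory.Balaban1983to89.T4TermFormat.Booking
open Literature.MathematicalPhysics.QuantumFieldTheory.Balaban1983to89.T4GatedBooking
open Literature.MathematicalPhysics.QuantumFieldTheory.Balaban1983to89.T4TrajectoryComparison
open Literature.MathematicalPhysics.QuantumFieldTheory.Balaban1983to89.T4TrajectoryModulus
open Summit.QuantumFields.BalabanUV.T4Continuum.T4TrajectoryDensityDressed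
open Summit.QuantumFields.BalabanUV.T4Continuum.NE1p.DressedRoot
open Summit.QuantumFields.BalabanUV.T4Continuum.NE1p.DressedTransportAssembled
open Summit.QuantumFields.BalabanUV.T4Continuum.NE1p.DressedTransportAssembledMod
open Summit.QuantumFields.BalabanUV.T4Continuum.NE1p.DressedRootWin
open T4BirthChartTransport (GaugeInvariant BirthSlice RelGauge)
open T4BlockTransport (Fld NDir latMove latN latMove_zero)
open T4TrajectoryDensity

/-! ## END-F′-mod-win: `hP` from the response moduli, per-step chart windows [bookkeeping] -/

section FunctionLevel

variable {B : T4TermFormat.Booking} {T : Trajectory B}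
variable {R : Type*} [NormedRing R] [NormedAlgebra ℂ R] [MeasurableSpace R] {d : ℕ}

/-- **END-F′-mod-win — THE TRANSPORT LEAF `htr` OF `BookingLeaves` WITH `hP` FROM THE RESPONSE MODULI AND PER-STEP CHART
WINDOWS** [bookkeeping]: `DressedTransportAssembledMod.transportLeaf_assembled_mod` VERBATIM except the nesting binder (N2), re-cut
to chart motions of declared bound `≤ wk b k′ (k+1)`, the window binders `hθwk : θ b k ≤ wk b k′ k`, `hwk : wk ≤ w`, `hwk_anti`, the
fresh pairs in the generation's own window `hδfwk : δf b k p ≤ wk p.1 p.2 k` (replacing `hδfw`) and `hdefwk : defect b k′ k ≤ wk b k′ k`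
(replacing `hdefw`).  Inside: (a)/(b) as END-F′-mod (`budgetShare_le_mod`, the dressed gate IS the function-level budget); (c)
`T4TrajectoryDensityAssemblyModWin.pertSlice_under_history_mod_win` + `PertSlice.mono`; (d) END-F-win
`DressedRootWin.transportLeaf_of_centredExponent_win` BY NAME.  What ties this face to `UniformConstants`: `C = 4c_δ/r` (birth radius),
the rate `ψ·α` and `‖c b k‖ ≤ m` — NO chart-radius floor; what it consumes of the birth window along a family's life: `Σ_k (wk b k′ k
+ diam D b k)` through (N1)/(N2), but STILL `≥ w + ϱ₁ b k + diam D b k` PER MET STEP through the cross-family complex margin `hN2cx` /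
`hpairx`, which stay typed at the uniform slice window `w` (finding F-ne1pleaf04-1: the assembled leaf's birth window is `≥ K·w + Σ`;
the per-step SLICE-window re-cut removes it — not done here).  Conclusion: EXACTLY the field `htr` of `BookingLeaves` with
`C = 4c_δ/r`, `ρ i = ψ·α i`.  Nothing of Bałaban's densities is asserted. [folklore] -/
theorem transportLeaf_assembled_mod_win {Fn : B.Birth → ℕ → ℕ → Fld d R → ℂ}
    {rel : B.Birth → ℕ → ℕ → Fld d R → Fld d R → Prop} {𝒦 : B.Birth → ℕ → ℕ → Set (Fld d R)}
    {ref : B.Birth → ℕ → Fld d R → Fld d R} {base : B.Birth → ℕ → Fld d R → ℝ}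
    {𝒜 𝒬 : B.Birth → ℕ → Fld d R → Fld d R → ℂ} {q : B.Birth → ℕ → Fld d R → ℂ}
    {μ : B.Birth → ℕ → Measure (Fld d R)} {z₀ z₁ : B.Birth → ℕ → Fld d R} {D : B.Birth → ℕ → Set (Fld d R)}
    {defect : B.Birth → ℕ → ℕ → ℝ} {cδ ψ w r m : ℝ} {s θ s1 ϱ₁ : B.Birth → ℕ → ℝ} {α : ℕ → ℝ}
    {ϱ rs Asz wk : B.Birth → ℕ → ℕ → ℝ} {S : ℕ → B.Birth → Finset B.Birth}
    {Sg : ℕ → B.Birth → Finset (B.Birth × ℕ)} {c : B.Birth → ℕ → ℂ} {δf : B.Birth → ℕ → B.Birth × ℕ → ℝ}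
    (hα : ∀ i, 0 ≤ α i) (hr : 0 < r) (hw : 0 < w) (hcδ : 0 ≤ cδ) (hψ : 0 ≤ ψ)
    (hsl : ∀ (b : B.Birth) (k' : ℕ), B.birthScale b ≤ k' → k' ≤ B.K →
      RanBelow (budgetGate T s m S (4 * cδ / r) (fun i => ψ * α i)) k' →
      BirthSlice (Fn b k' k') latMove latN (𝒦 b k' k') w r (T.gen b k'))
    (hFn : ∀ (b : B.Birth) (k' k : ℕ), B.birthScale b ≤ k' → k' ≤ k → k + 1 ≤ B.K →
      RanBelow (budgetGate T s m S (4 * cδ / r) (fun i => ψ * α i)) (k + 1) →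
      ∀ U, Fn b k' (k + 1) U =
        wOp (expWeight (base b k) (𝒜 b k + 𝒬 b k)) (μ b k) (z₀ b k) U (fun z => Fn b k' k (U + z)))
    (h𝒢 : ∀ (b : B.Birth) (k' k : ℕ), B.birthScale b ≤ k' → k' ≤ k → k + 1 ≤ B.K →
      RanBelow (budgetGate T s m S (4 * cδ / r) (fun i => ψ * α i)) (k + 1) →
      ∀ U, (fun z => Fn b k' k (U + z)) ∈ BddClass ℂ (μ b k))
    (hD : ∀ b k, (D b k).Nonempty) (hϱ : ∀ b k' k, 0 < ϱ b k' k)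
    (hB : ∀ (b : B.Birth) (k' k : ℕ), B.birthScale b ≤ k' → k' ≤ k → k + 1 ≤ B.K →
      RanBelow (budgetGate T s m S (4 * cδ / r) (fun i => ψ * α i)) (k + 1) →
      RealBaseAt (ref b k) (base b k) (𝒜 b k) (μ b k) (𝒦 b k' (k + 1)))
    (hE : ∀ (b : B.Birth) (k' k : ℕ), B.birthScale b ≤ k' → k' ≤ k → k + 1 ≤ B.K →
      RanBelow (budgetGate T s m S (4 * cδ / r) (fun i => ψ * α i)) (k + 1) →
      ExponentSliceAt (ref b k) (𝒜 b k) (μ b k) latMove latN (𝒦 b k' (k + 1)) w (ϱ b k' k) (s b k))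
    -- the Assembly's dictionary: the centred observable-attached exponent IS the fresh sum over the live generations
    (hQ : ∀ b k, (fun U z => 𝒬 b k U z - q b k U) =
      fun U z => c b k * ∑ p ∈ Sg k b, (Fn p.1 p.2 k (U + z) - Fn p.1 p.2 k (U + z₁ b k)))
    (hSg : ∀ k b, ∀ p ∈ Sg k b, p.1 ∈ S k b ∧ B.birthScale p.1 ≤ p.2 ∧ p.2 ≤ k)
    -- the step budget in MODULUS form (closed form, booking currency)
    (hs1 : ∀ b k, s1 b k = ‖c b k‖ * ∑ p ∈ Sg k b, (4 / r * stepProd α p.2 k * T.gen p.1 p.2) * δf b k p)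
    -- slice sizes and radii of the live generations AS EQUALITIES, radii ORDERED (no floor)
    (hAsz_birth : ∀ f k'', Asz f k'' k'' = T.gen f k'') (hrs_birth : ∀ f k'', rs f k'' k'' = r)
    (hAsz_step : ∀ f k'' k, B.birthScale f ≤ k'' → k'' ≤ k →
      Asz f k'' (k + 1) = Real.exp (3 * (s f k + s1 f k)) * Asz f k'' k)
    (hrs_step : ∀ f k'' k, B.birthScale f ≤ k'' → k'' ≤ k → rs f k'' (k + 1) = ϱ f k'' k)
    (hrs_dec : ∀ f k'' k, B.birthScale f ≤ k'' → k'' ≤ k → ϱ f k'' k < rs f k'' k)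
    (hmargin : ∀ (b : B.Birth) (k' k : ℕ), B.birthScale b ≤ k' → k' ≤ k →
      ϱ b k' k < ϱ₁ b k ∧ 0 < ϱ₁ b k ∧ ∀ p ∈ Sg k b, ϱ₁ b k ≤ rs p.1 p.2 k)
    -- the cutoff-free source-vs-budget condition
    (hcm : ∀ b k, ‖c b k‖ ≤ m)
    (hδf : ∀ b k, ∀ p ∈ Sg k b, 0 ≤ δf b k p ∧ δf b k p ≤ cδ * ψ ^ (k - p.2))
    (hδfwk : ∀ b k, ∀ p ∈ Sg k b, δf b k p ≤ wk p.1 p.2 k)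
    (hDμ : ∀ b k, ∀ᵐ z ∂μ b k, z ∈ D b k)
    (hN1 : ∀ (b : B.Birth) (k' k : ℕ), B.birthScale b ≤ k' → k' ≤ k → k + 1 ≤ B.K →
      ∀ z ∈ D b k, ∀ U ∈ 𝒦 b k' (k + 1), U + z ∈ 𝒦 b k' k)
    -- (N2) RE-CUT: chart motions of declared bound ≤ the NEXT step's window only
    (hN2 : ∀ (b : B.Birth) (k' k : ℕ), B.birthScale b ≤ k' → k' ≤ k → k + 1 ≤ B.K →
      ∀ U₀ ∈ 𝒦 b k' (k + 1), ∀ p : NDir d R, latN p ≤ wk b k' (k + 1) → ∀ z' ∈ D b k,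
        latMove U₀ p 1 + z' ∈ 𝒦 b k' k)
    (hN1x : ∀ (b : B.Birth) (k' k : ℕ), B.birthScale b ≤ k' → k' ≤ k →
      ∀ p ∈ Sg k b, ∀ z ∈ D b k, ∀ U ∈ 𝒦 b k' (k + 1), U + z ∈ 𝒦 p.1 p.2 k)
    (hN2cx : ∀ (b : B.Birth) (k' k : ℕ), B.birthScale b ≤ k' → k' ≤ k →
      ∀ p ∈ Sg k b, ∀ U₀ ∈ 𝒦 b k' (k + 1), ∀ pd : NDir d R, 0 < latN pd → latN pd ≤ w →
        ∀ t ∈ tube (ϱ₁ b k / latN pd), latMove U₀ pd t + z₁ b k ∈ 𝒦 p.1 p.2 k)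
    (hpairx : ∀ (b : B.Birth) (k' k : ℕ), B.birthScale b ≤ k' → k' ≤ k →
      ∀ p ∈ Sg k b, ∀ U₀ ∈ 𝒦 b k' (k + 1), ∀ pd : NDir d R, 0 < latN pd → latN pd ≤ w →
        ∀ᵐ z ∂μ b k, ∀ t ∈ tube (ϱ₁ b k / latN pd),
          RelGauge (rel p.1 p.2 k) latMove latN (latMove U₀ pd t + z₁ b k) (latMove U₀ pd t + z) (δf b k p))
    (hdiam : ∀ b k, ∀ z ∈ D b k, ∀ z' ∈ D b k, ∀ x ν, ‖z x ν - z' x ν‖ ≤ θ b k)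
    (hθ : ∀ b k, 0 < θ b k ∧ θ b k ≤ w) (hθwk : ∀ b k' k, θ b k ≤ wk b k' k)
    (hwk : ∀ b k' k, wk b k' k ≤ w) (hwk_anti : ∀ b k' k, wk b k' (k + 1) ≤ wk b k' k)
    (hdom : ∀ (b : B.Birth) (k' k : ℕ), B.birthScale b ≤ k' → k' ≤ k → k + 1 ≤ B.K →
      Real.exp 3 * (1 + 4 * θ b k / ϱ b k' k) ≤ α k)
    (hinv : ∀ b k' k, GaugeInvariant (rel b k' k) (Fn b k' k))
    (hmeas : ∀ (b f : B.Birth) (k'' k : ℕ) (U : Fld d R), AEStronglyMeasurable (fun z => Fn f k'' k (U + z)) (μ b k))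
    (hdefwk : ∀ b k' k, defect b k' k ≤ wk b k' k)
    (hrate : ∀ (b : B.Birth) (k' k : ℕ), B.birthScale b ≤ k' → k' ≤ k → k ≤ B.K →
      defect b k' k ≤ cδ * ψ ^ (k - k'))
    (hlin : ∀ (b : B.Birth) (k' k : ℕ), B.birthScale b ≤ k' → k' ≤ k → k ≤ B.K →
      RanBelow (budgetGate T s m S (4 * cδ / r) (fun i => ψ * α i)) k → ∀ ε > 0,
      ∃ U₀ ∈ 𝒦 b k' k, ∃ U₁ : Fld d R, RelGauge (rel b k' k) latMove latN U₀ U₁ (defect b k' k) ∧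
        T.lin b k' k ≤ ‖Fn b k' k U₁ - Fn b k' k U₀‖ + ε) :
    T.TransportsFromVar (4 * cδ / r) (fun i => ψ * α i) (budgetGate T s m S (4 * cδ / r) (fun i => ψ * α i)) := by
  classical
  set G : ℕ → Prop := budgetGate T s m S (4 * cδ / r) (fun i => ψ * α i) with hG
  -- (a) the booked link, modulus form: the function-level budget is below the dressed budget's envelope share OUTRIGHT
  have hs1le : ∀ b k, s1 b k ≤ m * ∑ f ∈ S k b, T.envVar (4 * cδ / r) (fun i => ψ * α i) f k := by
    intro b k
    rw [hs1 b k]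
    exact budgetShare_le_mod hα hψ hcδ hr (norm_nonneg _) (hcm b k) (hSg k b) (hδf b k)
  -- (b) hence the dressed gate of scale `k` gives the function-level budget of every family alive at `k`
  have hbudget : ∀ k, k < B.K → G k → ∀ b : B.Birth, B.birthScale b ≤ k → s b k + s1 b k ≤ 1 := by
    intro k _ hg b hb
    have h := hg b hb
    linarith [hs1le b k]
  -- (c) the centred perturbation slice under the history, modulus form with per-step windows, at the dressed budget's size
  have hP : ∀ (b : B.Birth) (k' k : ℕ), B.birthScale b ≤ k' → k' ≤ k → k + 1 ≤ B.K → RanBelow G (k + 1) →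
      PertSlice (fun U z => 𝒬 b k U z - q b k U) (μ b k) latMove latN (𝒦 b k' (k + 1)) w (ϱ b k' k)
        (m * ∑ f ∈ S k b, T.envVar (4 * cδ / r) (fun i => ψ * α i) f k) := by
    intro b k' k hbk' hk'k hK hran
    have key := pertSlice_under_history_mod_win (Gate := G) (T := T) hα hr hw hsl hFn h𝒢 hD hϱ hB hE hQ
      (fun k b p hp => (hSg k b p hp).2) hs1 hAsz_birth hrs_birth hAsz_step hrs_step hrs_dec hmargin hDμ hN1 hN2 hN1x hN2cx
      hpairx hδfwk hwk hwk_anti hdiam hθ hθwk hdom hinv hmeas hbudget b k' k hbk' hk'k hK hran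
    exact key.mono (hs1le b k) le_rfl Subset.rfl
  -- (d) END-F-win by name
  exact transportLeaf_of_centredExponent_win hα hr hw hsl hFn h𝒢 hD hϱ hB hE hP hDμ hN1 hN2 hdiam hθ hθwk hwk hwk_anti hdom hinv
    hdefwk hrate hlin

end FunctionLevel

end Summit.QuantumFields.BalabanUV.T4Continuum.NE1p.DressedTransportAssembledModWin

end
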